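import Literature.AnabelianGeometry.SemiGraphs.SubgroupPresentationStabilizersTopology
import Literature.AnabelianGeometry.SemiGraphs.TemperedPiPresentation
import HarnessLib

/-!
# [SemiAnbd] Thm 3.7 (iii) p. 41 / Thm 5.4 p. 66: the dict2 tower inputs `hHK` / `hMK` / `hlift` / `hliftE`
# DISCHARGED OUTRIGHT at `π₁^temp(𝒢) = lim_n Gal(𝒢_{∞,n}/𝒢)` (T54-B, piece (P-K)-inst)

Mochizuki, *Semi-graphs of anabelioids*, Publ. RIMS **42** (2006), proof of Thm. 3.7 (iii) p. 41 ("Since the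
semi-graphs `𝔾_j` are all finite, it thus follows that `H`, `γ₁`, `γ₂` determine … a [compatible] system"),
with the author's Comments (2020) (6)(b) ("converge, in the profinite topology, to some … subjoint"), and the
proof of Thm. 5.4 p. 66 ("entirely similar") [cite: MochizukiSemiAnbd2006, Thm 3.7(iii) p.41].

PROOF-ONLY (cell row T54-B, producer debt `HOME/plan/GAP-LEDGER.md` G-w4d053-1; node SemiAnbd:Thm5.4).
abc-iut-w4-d053's constructor `ArithLevelDataCpt.ofCosetTower` carries abc-iut-w4-d059's dict2 ALGEBRAIC tower
inputs as binders — `hHK`/`hMK` (`⋂_j H_w·K_j = H_w`, resp. `M_e`) and `hlift`/`hliftE` (compatible double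
cosets `H_w y_j K_j` lift to one representative) — and `SubgroupPresentationStabilizersTopology.lean` (this
seat, (P-K)) reduces them to: the `K_j` open, antitone, meeting in `1`, `Γ` Hausdorff, `H_w`/`M_e` compact, and
the ONE honest input `hcomplete` ("`Γ` is complete for the `K_j`").  THIS FILE discharges all of these at the
tree's tempered fundamental group, so that the four binders become CLOSED THEOREMS at
`P := D.piPresentation h𝒢 T R`, `K n := ker (D.projAut h𝒢 n)`:

* `CountableDiscreteSystem.exists_forall_inv_mul_mem_ker_proj` — the limit `lim_i G_i ≤ ∏_i G_i` of ANY
  inverse system of (countable discrete) groups is COMPLETE for its level kernels `ker (lim → G_i)`: a family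
  `(z_i)_i` with `z_i⁻¹ z_j ∈ ker_i` (`i ≤ j`) has the limit `g := (ρ_i(z_i))_i` — the `hcomplete` binder of
  (P-K), by construction of the limit (no compactness: `π₁^temp` is not compact);
* at abc-iut-L3-t9's Galois tower `D` (`temperedPi = lim_n Gal(𝒢_{∞,n}/𝒢)`, projections `projAut n = ρ_n`):
  `temperedPi_complete_projAut` (`hcomplete` for `K n := ker ρ_n`), `ker_projAut_anti`, `isOpen_ker_projAut`,
  `eq_one_of_forall_mem_ker_projAut` (`⋂_n ker ρ_n = 1`), `t2Space_temperedPi`;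
* `isCompact_piPresentation_H` / `isCompact_piPresentation_M` — the vertex groups `H_w = D_t(Π_w)` and edge
  groups `M_e = D_t(Π_{β e})` of abc-iut-L3-d4's presentation are COMPACT (continuous images of the profinite
  `Π_w`, `Π_e` under abc-iut-L3-t6's decomposition homomorphism `decompHom`);
* **`piPresentation_hHK` / `piPresentation_hMK` / `piPresentation_hlift` / `piPresentation_hliftE`** — the four
  dict2 binders of `ArithLevelDataCpt.ofCosetTower` VERBATIM at `(P, K) := (D.piPresentation h𝒢 T R,
  fun n => ker (D.projAut h𝒢 n))`, with NO hypothesis left.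

Nothing here refers to the IUT corpus; no side is taken on [IUTchIII] Cor 3.12; typed ≠ proved for Thm 5.4 itself.
-/

namespace Literature.AnabelianGeometry.SemiGraphs

open Topology
open scoped Pointwise

universe u

/-! ### Generic: an inverse limit of discrete groups is complete for its level kernels -/

namespace CountableDiscreteSystem

variable (S : CountableDiscreteSystem.{u})

/-- **The limit `lim_i G_i` is complete for its level kernels** ("converge … to some subjoint", Comments
(6)(b)): if `z : ι → lim_i G_i` satisfies `z_i⁻¹ z_j ∈ ker ρ_i` for `i ≤ j`, then some `g` has
`g⁻¹ z_i ∈ ker ρ_i` for every `i` — namely `g := (ρ_i(z_i))_i`, which lies in the limit.  This is the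
`hcomplete` binder of `SubgroupPresentationStabilizersTopology.lean`, by construction.
[cite: MochizukiSemiAnbd2006, Thm 3.7(iii) p.41] -/
theorem exists_forall_inv_mul_mem_ker_proj (z : S.ι → S.limit)
    (hz : ∀ ⦃i j : S.ι⦄, i ≤ j → (z i)⁻¹ * z j ∈ (S.proj i).ker) :
    ∃ g : S.limit, ∀ i, g⁻¹ * z i ∈ (S.proj i).ker := by
  have hcompat : ∀ ⦃i j : S.ι⦄, i ≤ j → S.proj i (z j) = S.proj i (z i) := by
    intro i j h
    have h1 := hz h
    rw [MonoidHom.mem_ker, map_mul, map_inv, inv_mul_eq_one] at h1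
    exact h1.symm
  refine ⟨⟨fun i => S.proj i (z i), fun i j h => ?_⟩, fun i => ?_⟩
  · -- compatibility of `(ρ_i(z_i))_i`: `map h (ρ_j z_j) = ρ_i z_j = ρ_i z_i`
    show S.map h (S.proj j (z j)) = S.proj i (z i)
    rw [← hcompat h]
    exact (z j).2 h
  · rw [MonoidHom.mem_ker, map_mul, map_inv, inv_mul_eq_one]
    rfl

end CountableDiscreteSystem

/-! ### At the Galois tower: `π₁^temp(𝒢)` and its level kernels `ker ρ_n` -/

namespace ProfiniteSemiGraph

namespace GaloisLevelData

open CategoryTheory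

variable {𝒢 : ProfiniteSemiGraph.{u}} (D : GaloisLevelData 𝒢) (h𝒢 : 𝒢.IsCountable)

/-- **`π₁^temp(𝒢)` is complete for the kernels `ker ρ_n`** — the `hcomplete` binder of (P-K) at
`K n := ker (D.projAut n)`, by construction of `π₁^temp = lim_n Gal(𝒢_{∞,n}/𝒢)`.
[cite: MochizukiSemiAnbd2006, Thm 3.7(iii) p.41] -/
theorem temperedPi_complete_projAut (z : ℕ → D.temperedPi h𝒢)
    (hz : ∀ ⦃i j : ℕ⦄, i ≤ j → (z i)⁻¹ * z j ∈ (D.projAut h𝒢 i).ker) :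
    ∃ g : D.temperedPi h𝒢, ∀ j, g⁻¹ * z j ∈ (D.projAut h𝒢 j).ker := by
  obtain ⟨g, hg⟩ := (D.system h𝒢).exists_forall_inv_mul_mem_ker_proj (fun i => z i.down)
    (fun i j h => hz (i := i.down) (j := j.down) h)
  exact ⟨g, fun j => hg ⟨j⟩⟩

/-- The level kernels `ker ρ_n` are antitone in `n`. [cite: MochizukiSemiAnbd2006, Prop 3.6 p.38] -/
theorem ker_projAut_anti ⦃i j : ℕ⦄ (h : i ≤ j) : (D.projAut h𝒢 j).ker ≤ (D.projAut h𝒢 i).ker := by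
  intro x hx
  rw [MonoidHom.mem_ker] at hx ⊢
  change D.proj h𝒢 j x = 1 at hx
  change D.proj h𝒢 i x = 1
  rw [← D.mapLE_proj h𝒢 h x, hx, map_one]

/-- The level kernels `ker ρ_n` are open. [cite: MochizukiSemiAnbd2006, Prop 3.6 p.38] -/
theorem isOpen_ker_projAut (n : ℕ) : IsOpen ((D.projAut h𝒢 n).ker : Set (D.temperedPi h𝒢)) :=
  D.isOpen_ker_proj h𝒢 n

/-- The level kernels `ker ρ_n` meet in `1` (`π₁^temp ≤ ∏_n Gal(𝒢_{∞,n}/𝒢)`).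
[cite: MochizukiSemiAnbd2006, Prop 3.6(iii) p.38] -/
theorem eq_one_of_forall_mem_ker_projAut (g : D.temperedPi h𝒢) (hg : ∀ n, g ∈ (D.projAut h𝒢 n).ker) :
    g = 1 :=
  D.pi_ext h𝒢 fun n => by
    rw [map_one]
    exact hg n

/-- `π₁^temp(𝒢)` is Hausdorff (a subgroup of a product of discrete groups); stated as a theorem — consumers
write `haveI := D.t2Space_temperedPi h𝒢`. [cite: MochizukiSemiAnbd2006, Prop 3.6(i) p.38] -/
theorem t2Space_temperedPi : T2Space (D.temperedPi h𝒢) :=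
  inferInstanceAs (T2Space (D.system h𝒢).limit)

/-! ### Compactness of the presentation's vertex and edge groups -/

variable (T : ∀ w : 𝒢.graph.Vertex, D.PointSeq h𝒢 w) (R : SemiGraph.RefBranches 𝒢.graph)

/-- **The vertex groups `H_w = D_t(Π_w)` of the presentation are compact** (continuous image of the profinite
`Π_w` under the decomposition homomorphism). [cite: MochizukiSemiAnbd2006, Thm 3.7(i) p.40] -/
theorem isCompact_piPresentation_H (w : 𝒢.graph.Vertex) :
    IsCompact (((D.piPresentation h𝒢 T R).H w : Subgroup (D.temperedPi h𝒢)) : Set (D.temperedPi h𝒢)) := by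
  rw [D.piPresentation_H h𝒢 T R w, MonoidHom.coe_range]
  exact isCompact_range (T w).continuous_decompHom

/-- **The edge groups `M_e = D_t(Π_{β e})` of the presentation are compact** (continuous image of the compact
`Π_b = b_*(Π_e) ≤ Π_{ν e}`). [cite: MochizukiSemiAnbd2006, Thm 3.7(i) p.40] -/
theorem isCompact_piPresentation_M (e : 𝒢.graph.Edge) :
    IsCompact (((D.piPresentation h𝒢 T R).M e : Subgroup (D.temperedPi h𝒢)) : Set (D.temperedPi h𝒢)) := by
  rw [D.piPresentation_M h𝒢 T R e, Subgroup.coe_map]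
  refine IsCompact.image ?_ (T (R.ν e)).continuous_decompHom
  unfold ProfiniteSemiGraph.branchSubgroup
  rw [MonoidHom.coe_range]
  exact isCompact_range (map_continuous (𝒢.brHom (R.β e) (R.ν e) (R.abuts_β e)))

/-! ### The four dict2 binders of `ArithLevelDataCpt.ofCosetTower`, closed at `π₁^temp(𝒢)` -/

/-- **`hHK` at `π₁^temp(𝒢)`**: `⋂_n H_w · ker ρ_n = H_w` for the vertex groups of `D.piPresentation T R` —
the binder `hHK` of `ArithLevelDataCpt.ofCosetTower` at `K n := ker ρ_n`, no hypothesis.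
[cite: MochizukiSemiAnbd2006, Thm 3.7(iii) p.41] -/
theorem piPresentation_hHK :
    ∀ (w : 𝒢.graph.Vertex) (x : D.temperedPi h𝒢),
      (∀ j : ℕ, x ∈ ((D.piPresentation h𝒢 T R).H w : Set (D.temperedPi h𝒢)) *
        ((D.projAut h𝒢 j).ker : Set (D.temperedPi h𝒢))) →
      x ∈ (D.piPresentation h𝒢 T R).H w := by
  haveI := D.t2Space_temperedPi h𝒢
  exact (D.piPresentation h𝒢 T R).hHK_of_isCompact (fun n => (D.projAut h𝒢 n).ker)
    (D.ker_projAut_anti h𝒢) (D.isOpen_ker_projAut h𝒢) (D.eq_one_of_forall_mem_ker_projAut h𝒢)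
    (D.isCompact_piPresentation_H h𝒢 T R)

/-- **`hMK` at `π₁^temp(𝒢)`**: `⋂_n M_e · ker ρ_n = M_e` for the edge groups — the binder `hMK` of
`ArithLevelDataCpt.ofCosetTower` at `K n := ker ρ_n`, no hypothesis. [cite: MochizukiSemiAnbd2006, Thm 3.7(iii) p.41] -/
theorem piPresentation_hMK :
    ∀ (e : 𝒢.graph.Edge) (x : D.temperedPi h𝒢),
      (∀ j : ℕ, x ∈ ((D.piPresentation h𝒢 T R).M e : Set (D.temperedPi h𝒢)) *
        ((D.projAut h𝒢 j).ker : Set (D.temperedPi h𝒢))) →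
      x ∈ (D.piPresentation h𝒢 T R).M e := by
  haveI := D.t2Space_temperedPi h𝒢
  exact (D.piPresentation h𝒢 T R).hMK_of_isCompact (fun n => (D.projAut h𝒢 n).ker)
    (D.ker_projAut_anti h𝒢) (D.isOpen_ker_projAut h𝒢) (D.eq_one_of_forall_mem_ker_projAut h𝒢)
    (D.isCompact_piPresentation_M h𝒢 T R)

/-- **`hlift` at `π₁^temp(𝒢)`**: every compatible system of double cosets `(H_w y_n ker ρ_n)_n` comes from ONE
representative — the binder `hlift` of `ArithLevelDataCpt.ofCosetTower` at `K n := ker ρ_n`, no hypothesis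
(Kőnig on the finite sets of `H_w`-translates, then completeness of the limit).
[cite: MochizukiSemiAnbd2006, Thm 3.7(iii) p.41] -/
theorem piPresentation_hlift :
    ∀ (w : 𝒢.graph.Vertex) (y : ℕ → D.temperedPi h𝒢),
      (∀ ⦃i j : ℕ⦄, i ≤ j →
        DoubleCoset.mk ((D.piPresentation h𝒢 T R).H w) ((D.projAut h𝒢 i).ker) (y j) =
          DoubleCoset.mk ((D.piPresentation h𝒢 T R).H w) ((D.projAut h𝒢 i).ker) (y i)) →
      ∃ z : D.temperedPi h𝒢, ∀ j,
        DoubleCoset.mk ((D.piPresentation h𝒢 T R).H w) ((D.projAut h𝒢 j).ker) z =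
          DoubleCoset.mk ((D.piPresentation h𝒢 T R).H w) ((D.projAut h𝒢 j).ker) (y j) :=
  (D.piPresentation h𝒢 T R).hlift_of_complete (fun n => (D.projAut h𝒢 n).ker)
    (D.ker_projAut_anti h𝒢) (D.isOpen_ker_projAut h𝒢) (D.temperedPi_complete_projAut h𝒢)
    (D.isCompact_piPresentation_H h𝒢 T R)

/-- **`hliftE` at `π₁^temp(𝒢)`**: the same for the edge groups `M_e` over every final segment `{j // j₁ ≤ j}` —
the binder `hliftE` of `ArithLevelDataCpt.ofCosetTower` at `K n := ker ρ_n`, no hypothesis.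
[cite: MochizukiSemiAnbd2006, Thm 3.7(iii) p.41] -/
theorem piPresentation_hliftE :
    ∀ (j₁ : ℕ) (e : 𝒢.graph.Edge) (y : {j : ℕ // j₁ ≤ j} → D.temperedPi h𝒢),
      (∀ ⦃i j : {j : ℕ // j₁ ≤ j}⦄, i.1 ≤ j.1 →
        DoubleCoset.mk ((D.piPresentation h𝒢 T R).M e) ((D.projAut h𝒢 i.1).ker) (y j) =
          DoubleCoset.mk ((D.piPresentation h𝒢 T R).M e) ((D.projAut h𝒢 i.1).ker) (y i)) →
      ∃ z : D.temperedPi h𝒢, ∀ j,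
        DoubleCoset.mk ((D.piPresentation h𝒢 T R).M e) ((D.projAut h𝒢 j.1).ker) z =
          DoubleCoset.mk ((D.piPresentation h𝒢 T R).M e) ((D.projAut h𝒢 j.1).ker) (y j) :=
  fun j₁ => (D.piPresentation h𝒢 T R).hliftE_of_complete (fun n => (D.projAut h𝒢 n).ker)
    (D.ker_projAut_anti h𝒢) (D.isOpen_ker_projAut h𝒢) (D.temperedPi_complete_projAut h𝒢)
    (D.isCompact_piPresentation_M h𝒢 T R) j₁

end GaloisLevelData

end ProfiniteSemiGraph

end Literature.AnabelianGeometry.SemiGraphs
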